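import Summits.HodgeConjecture.HodgeConjecture.Theorems.Ring2AbelianAllLefschetzPencilsQuasiInverseHodge
import Summits.HodgeConjecture.HodgeConjecture.Theorems.Ring2AbelianAllAndreFibreClassKernelOfDeligne
import Literature.AlgebraicGeometry.HodgeTheory.InvariantClassesFromTotalSpaceHolds
import HarnessLib

/-!
# Ring 2 · sub-cell AbelianAll (ALL ABELIAN VARIETIES), André axis — ab-andre-1 part XIII: the RE-BASE of part
# XII on the tree theorem (κ) — every `κ` binder of the rows `(5∀)/(5)/(5)_d ⟹[Q_H; κ, φ] (β…)` and of the row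
# `HC_CM ⟹[h₂₁; Q_H, κ; (5)] HC_AV` DROPPED (REFEREE-AB R-12 F-ab-43)

HONEST FRAMING (page 1, verbatim): **research route, not a corollary; conditional on HC_CM plus one named
minimal statement.** Cell line: research route conditional on HC_CM; not a corollary; Q11.4-sentence-2
already refuted in dim ≥ 3. Nothing in this file proves an open case of the Hodge conjecture; `HC_CM`
(`RankFourFaces.CMAbelianHodge`) and `HC_AV` (`PadicSemiregularLift.HodgeAbelianVarieties`) occur only as a
binder resp. a conclusion under open binders. Seat `pub-hodge-ring2-ab-andre-1`, gen 10; sequel of part XII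
(`Ring2AbelianAllLefschetzPencilsQuasiInverseHodge`, node (Q_H) and the edges modulo `(Q_H), (κ), (φ)`), citing
ab-andre-2's part XII-b (`Ring2AbelianAllAndreFibreClassKernelOfDeligne`) and the Literature theorem file
`InvariantClassesFromTotalSpaceHolds` by name; nothing copied, nothing restated.

## Why this part exists

REFEREE-AB R-11 F-ab-39: the supply node (κ) `FibreGysinKernelCompactPencils` ("on a compact pencil of abelian
varieties, `j_{t*} j_t^* W = 0 ⟹ j_s^* W = 0` for every fibre") is an UNCONDITIONAL THEOREM OF THE TREE —
ab-andre-2's `fibreGysinKernelCompactPencils_of_deligne1968 (h418)` (part XII-b: top-degree injectivity of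
`j_{t*}`, the polarisation on the sub-Hodge structure `Im j_t^*`, André's flatness) applied to
`h418 := deligne1968_invariantClass_fromTotalSpace`, which is PROVED in `Literature/` as
`deligne1968_invariantClass_fromTotalSpace_holds` (Voisin II Thm. 4.18 / Deligne 1968, formalised: Ehresmann,
relative hard Lefschetz, degeneration). REFEREE-AB R-12 F-ab-43 then asks this seat to drop the `hκ` binders of
part XII's rows `HC_AV_of_HC_CM_of_quasiInverseHodge_of_kernel_of_lefschetzBCMPointedPencils` (l.318) and
`lefschetzB_to_fibreClass_chain_hodge` (l.339) "by one term". The gate keeps landed theorem statements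
APPEND-ONLY (`theorems.append-only`: deprecate, do not mutate), so the binder cannot be deleted in place: the
re-based rows are the NEW declarations below — part XII's names with a prime `'` (the sub-cell's convention for
κ-free forms), resp. the row renamed without `_of_kernel` — each ONE application of the part-XII theorem to the
closed term

  `κ♭ := fibreGysinKernelCompactPencils_of_deligne1968 deligne1968_invariantClass_fromTotalSpace_holds`

(per pencil: `fibreGysinKernelOn_of_deligne1968 deligne1968_invariantClass_fromTotalSpace_holds hf`). `κ♭` is
prose shorthand in this docstring only; the file declares NO name for it (ab-andre-2's part XII-e names the same
term `fibreGysinKernelCompactPencils_holds` — count once). Part XII's κ-rows remain in the tree unchanged (the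
more explicit statements, with (κ) displayed); for citation and for the census the primed rows supersede them,
and every edge label `K[Q_H; κ]` / `K[Q_H; κ, φ]` of part XII reads `K[Q_H]` / `K[Q_H; φ]` here (LEAD census v9:
κ ∈ cl(∅); labels of record K[Q_H; φ̂] once (φ) is read through typer2's Fulton wrapper, not imported here).

## Rows (13 theorems, all one-line applications; no mathematics added)

* §W per pencil: `(Q_H) ∧ B(𝒳) ⟹ (β′ᵖᵗ_f)` (`fibreClassLefschetzPointwiseOn_of_standardConjectureBStar'`),
  `(Q_H) ∧ (φ_f) ∧ B(𝒳) ⟹ (β′_f)` (`fibreClassLefschetzOn_of_standardConjectureBStar'`).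
* §X blanket / graded: `(5∀) ⟹[Q_H] (β∀′ᵖᵗ)`, `(5∀) ⟹[Q_H; φ] (β∀′)`, `(5) ⟹[Q_H] (β′ᵖᵗ)`, `(5) ⟹[Q_H; φ] (β′)`,
  `(5)_d ⟹[Q_H; φ] (β′)_d`, `(5∀)_d ⟹[Q_H; φ] (β′)_d`; the rung `d = 2` and `∀ d ≤ 2` from Tankeev's `h_T` modulo
  `(Q_H), (φ)`; `(β′) ↔ ∀ d ≥ 3, (β′)_d` modulo `(Q_H), (φ), h_T`.
* §Y the row **`HC_CM ⟹[h₂₁; Q_H; (5)] HC_AV`** (`HC_AV_of_HC_CM_of_quasiInverseHodge_of_lefschetzBCMPointedPencils`: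
  binders `h₂₁` = André's Lemme 6.3.1 named fact, `hQ : (Q_H)`, `hCM : HC_CM`, `h₅ : (5)` — and nothing else) and
  the edge table `lefschetzB_to_fibreClass_chain_hodge'` with the single supply binder `hφ`.

## What is NOT claimed
Not that (Q_H), (Q), (φ), (5), (5∀), `h_T`, `h₂₁`, `HC_CM` are proved — HYPOTHESES, never facts ((Q_H) is a case
of the summit by part XII's `of_hodgeConjecture`; (φ) follows from the named fact `Fulton1998_map_fundamentalClass_fibre_eq`
by typer2's wrapper, not used here); not that any node is "minimal" (F-ab-4); not `HC_AV ⟹ (5)`, no monotonicity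
in `d`, not the converse `(β′) ⟹ (5)`; no statement of parts I–XII or of ab-andre-2's parts is revised or
restated. (κ) is CONSUMED as the theorem it is; its proof is ab-andre-2's and the Literature seat's, cited by name.
Literature keys cited: VoisinHodgeII2003 (§4.3.1 Thm. 4.18); DeligneHodgeII1971 (Thm. 4.1.1, 4.2.6); Deligne1968
((2.1), (2.6.3)); Andre1996Motifs (Lemme 6.3.1 p. 31, §6.3 Remarque 2 p. 33, Prop. 3.3 pp. 21–22);
Abdulali1994FamiliesAV (Conj. 5.3, Thm. 5.5, Thm. 6.1 (b), pp. 1130–1131); Tankeev2011 (main theorem);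
GreenMurreVoisin1994 (Murre §7.7). No `sorry`, no new axiom, no `def`.
-/

noncomputable section

-- The summit's namespace repeats `HodgeConjecture` (summit = sub-problem); every file of the axis disables this linter.
set_option linter.dupNamespace false

namespace Summit.HodgeConjecture.HodgeConjecture.Ring2.AbelianAll

open CategoryTheory AlgebraicGeometry MonoidalCategory
open Literature.AlgebraicGeometry Literature.AlgebraicGeometry.Motives
open Literature.AlgebraicGeometry.HodgeTheory
open Literature.AlgebraicGeometry.Andre1996 (andre1996_cmAnchoredPencil)
open Literature.AlgebraicGeometry.Tankeev2011 (Tankeev2011_lefschetzStandard_abelianSurfacePencilThreefold)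
open Summit.HodgeConjecture.HodgeConjecture
open Summit.HodgeConjecture.HodgeConjecture.Theses

variable {𝒳 S : SchemeOver ℂ}

namespace AlgebraicQuasiInverseOfLefschetzStandardHodge

/-! ## §W Per pencil, (κ_f) consumed as a theorem -/

/-- **`(Q_H) ∧ B(𝒳) ⟹ (β′ᵖᵗ_f)`** — part XII's `fibreClassLefschetzPointwiseOn_of_standardConjectureBStar` with its
`hκ : FibreGysinKernelOn hf` binder met by the tree theorem (XII-b ∘ Voisin II Thm. 4.18 formalised); F-ab-43.
[cite: Andre1996Motifs, §6.3 Remarque 2 (p. 33)] [cite: VoisinHodgeII2003, §4.3.1 Thm. 4.18]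
[cite: DeligneHodgeII1971, Thm. 4.1.1 and 4.2.6] -/
theorem fibreClassLefschetzPointwiseOn_of_standardConjectureBStar'
    (hQ : AlgebraicQuasiInverseOfLefschetzStandardHodge) {d : ℕ} {f : 𝒳 ⟶ S} (hf : IsCompactAbelianPencil f d)
    (hB : ∀ η : complexBetti 𝒳 2, StandardConjectureBStar (d + 1) 𝒳 η) : FibreClassLefschetzPointwiseOn hf :=
  hQ.fibreClassLefschetzPointwiseOn_of_standardConjectureBStar hf
    (fibreGysinKernelOn_of_deligne1968 deligne1968_invariantClass_fromTotalSpace_holds hf) hB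

/-- **`(Q_H) ∧ (φ_f) ∧ B(𝒳) ⟹ (β′_f)`** — part XII's `fibreClassLefschetzOn_of_standardConjectureBStar`, κ-free
(ab-andre-2's split `(β′_f) ⟺ (κ_f) ∧ (A_f)` with (κ_f) a theorem). [cite: Abdulali1994FamiliesAV, Conjecture 5.3 and Theorem 5.5 (p. 1130)]
[cite: Andre1996Motifs, §6.3 Remarque 2 (p. 33)] [cite: VoisinHodgeII2003, §4.3.1 Thm. 4.18] -/
theorem fibreClassLefschetzOn_of_standardConjectureBStar'
    (hQ : AlgebraicQuasiInverseOfLefschetzStandardHodge) {d : ℕ} {f : 𝒳 ⟶ S} (hf : IsCompactAbelianPencil f d)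
    (hφ : FibreClassConstantOn hf) (hB : ∀ η : complexBetti 𝒳 2, StandardConjectureBStar (d + 1) 𝒳 η) :
    FibreClassLefschetzOn hf :=
  hQ.fibreClassLefschetzOn_of_standardConjectureBStar hf
    (fibreGysinKernelOn_of_deligne1968 deligne1968_invariantClass_fromTotalSpace_holds hf) hφ hB

/-! ## §X Blanket and graded edges modulo (Q_H), (φ) only -/

/-- **`(5∀) ⟹[Q_H] (β∀′ᵖᵗ)`** (part XII's row, κ-free). [cite: Andre1996Motifs, §6.3 Remarque 2 (p. 33)]
[cite: VoisinHodgeII2003, §4.3.1 Thm. 4.18] -/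
theorem fibreClassLefschetzPointwiseCompactPencils_of_lefschetzBCompactPencils'
    (hQ : AlgebraicQuasiInverseOfLefschetzStandardHodge) (h₅ : LefschetzBCompactPencils) :
    FibreClassLefschetzPointwiseCompactPencils :=
  hQ.fibreClassLefschetzPointwiseCompactPencils_of_lefschetzBCompactPencils
    (fibreGysinKernelCompactPencils_of_deligne1968 deligne1968_invariantClass_fromTotalSpace_holds) h₅

/-- **`(5∀) ⟹[Q_H; φ] (β∀′)`** (part XII's row, κ-free). [cite: Andre1996Motifs, §6.3 Remarque 2 (p. 33)]
[cite: Abdulali1994FamiliesAV, Theorem 5.5 (p. 1130)] -/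
theorem fibreClassLefschetzOnCompactPencils_of_lefschetzBCompactPencils'
    (hQ : AlgebraicQuasiInverseOfLefschetzStandardHodge) (hφ : FibreClassConstantCompactPencils)
    (h₅ : LefschetzBCompactPencils) : FibreClassLefschetzOnCompactPencils :=
  hQ.fibreClassLefschetzOnCompactPencils_of_lefschetzBCompactPencils
    (fibreGysinKernelCompactPencils_of_deligne1968 deligne1968_invariantClass_fromTotalSpace_holds) hφ h₅

/-- **`(5) ⟹[Q_H] (β′ᵖᵗ)`** (CM-pointed compact pencils; part XII's row, κ-free).
[cite: Andre1996Motifs, Lemme 6.3.1 (p. 31) and §6.3 Remarque 2 (p. 33)] -/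
theorem fibreClassLefschetzPointwiseCMPointedPencils_of_lefschetzBCMPointedPencils'
    (hQ : AlgebraicQuasiInverseOfLefschetzStandardHodge) (h₅ : LefschetzBCMPointedPencils) :
    FibreClassLefschetzPointwiseCMPointedPencils :=
  hQ.fibreClassLefschetzPointwiseCMPointedPencils_of_lefschetzBCMPointedPencils
    (fibreGysinKernelCompactPencils_of_deligne1968 deligne1968_invariantClass_fromTotalSpace_holds) h₅

/-- **`(5) ⟹[Q_H; φ] (β′)`** — THE EDGE of REFEREE-AB R-09/R-10, now kernel modulo the two print-true supply nodes
(Q_H) (a case of the summit, part XII) and (φ) (a consequence of Fulton's named fact) ONLY; part XII's row, κ-free.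
[cite: Andre1996Motifs, Lemme 6.3.1 (p. 31) and §6.3 Remarque 2 (p. 33)] [cite: Abdulali1994FamiliesAV, Conjecture 5.3 (p. 1130)] -/
theorem fibreClassLefschetzOnCMPointedPencils_of_lefschetzBCMPointedPencils'
    (hQ : AlgebraicQuasiInverseOfLefschetzStandardHodge) (hφ : FibreClassConstantCompactPencils)
    (h₅ : LefschetzBCMPointedPencils) : FibreClassLefschetzOnCMPointedPencils :=
  hQ.fibreClassLefschetzOnCMPointedPencils_of_lefschetzBCMPointedPencils
    (fibreGysinKernelCompactPencils_of_deligne1968 deligne1968_invariantClass_fromTotalSpace_holds) hφ h₅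

/-- **Graded: `(5)_d ⟹[Q_H; φ] (β′)_d`** (part XII's row, κ-free). [cite: Andre1996Motifs, §6.3 Remarque 2 (p. 33)] -/
theorem fibreClassLefschetzOnAtRelDim_of_lefschetzBCMPointedPencilsAtRelDim'
    (hQ : AlgebraicQuasiInverseOfLefschetzStandardHodge) {d : ℕ} (hφ : FibreClassConstantCompactPencils)
    (h₅ : LefschetzBCMPointedPencilsAtRelDim d) : FibreClassLefschetzOnAtRelDim d :=
  hQ.fibreClassLefschetzOnAtRelDim_of_lefschetzBCMPointedPencilsAtRelDim
    (fibreGysinKernelCompactPencils_of_deligne1968 deligne1968_invariantClass_fromTotalSpace_holds) hφ h₅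

/-- Graded: `(5∀)_d ⟹[Q_H; φ] (β′)_d` (part XII's row, κ-free). [cite: Andre1996Motifs, §6.3 Remarque 2 (p. 33)] -/
theorem fibreClassLefschetzOnAtRelDim_of_lefschetzBCompactPencilsAtRelDim'
    (hQ : AlgebraicQuasiInverseOfLefschetzStandardHodge) {d : ℕ} (hφ : FibreClassConstantCompactPencils)
    (h₅ : LefschetzBCompactPencilsAtRelDim d) : FibreClassLefschetzOnAtRelDim d :=
  hQ.fibreClassLefschetzOnAtRelDim_of_lefschetzBCompactPencilsAtRelDim
    (fibreGysinKernelCompactPencils_of_deligne1968 deligne1968_invariantClass_fromTotalSpace_holds) hφ h₅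

/-- **The rung `(β′)_2` modulo (Q_H), (φ) and Tankeev's `h_T`** (part XII's row, κ-free).
[cite: Tankeev2011, main theorem (κ(X) < 3)] [cite: Andre1996Motifs, §6.3 Remarque 2 (p. 33)] -/
theorem fibreClassLefschetzOnAtRelDim_two_of_tankeev2011'
    (hQ : AlgebraicQuasiInverseOfLefschetzStandardHodge) (hφ : FibreClassConstantCompactPencils)
    (hT : Tankeev2011_lefschetzStandard_abelianSurfacePencilThreefold) : FibreClassLefschetzOnAtRelDim 2 :=
  hQ.fibreClassLefschetzOnAtRelDim_two_of_tankeev2011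
    (fibreGysinKernelCompactPencils_of_deligne1968 deligne1968_invariantClass_fromTotalSpace_holds) hφ hT

/-- **`(β′)_d` for every `d ≤ 2` modulo (Q_H), (φ), `h_T`** (part XII's row, κ-free).
[cite: Tankeev2011, main theorem (κ(X) < 3)] [cite: GreenMurreVoisin1994, Murre §7.7 (PDF p. 123)] -/
theorem fibreClassLefschetzOnAtRelDim_of_le_two_of_tankeev2011'
    (hQ : AlgebraicQuasiInverseOfLefschetzStandardHodge) (hφ : FibreClassConstantCompactPencils)
    (hT : Tankeev2011_lefschetzStandard_abelianSurfacePencilThreefold) {d : ℕ} (hd : d ≤ 2) :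
    FibreClassLefschetzOnAtRelDim d :=
  hQ.fibreClassLefschetzOnAtRelDim_of_le_two_of_tankeev2011
    (fibreGysinKernelCompactPencils_of_deligne1968 deligne1968_invariantClass_fromTotalSpace_holds) hφ hT hd

/-- **Granted (Q_H), (φ) and `h_T`, (β′) is EQUIVALENT to its restriction to relative dimension `d ≥ 3`** (part
XII's row, κ-free). [cite: Tankeev2011, main theorem (κ(X) < 3)] [cite: Andre1996Motifs, §6.3 Remarque 2 (p. 33)] -/
theorem fibreClassLefschetzOnCMPointedPencils_iff_forall_three_le_of_tankeev2011'
    (hQ : AlgebraicQuasiInverseOfLefschetzStandardHodge) (hφ : FibreClassConstantCompactPencils)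
    (hT : Tankeev2011_lefschetzStandard_abelianSurfacePencilThreefold) :
    FibreClassLefschetzOnCMPointedPencils ↔ ∀ d : ℕ, 3 ≤ d → FibreClassLefschetzOnAtRelDim d :=
  hQ.fibreClassLefschetzOnCMPointedPencils_iff_forall_three_le_of_tankeev2011
    (fibreGysinKernelCompactPencils_of_deligne1968 deligne1968_invariantClass_fromTotalSpace_holds) hφ hT

end AlgebraicQuasiInverseOfLefschetzStandardHodge

/-! ## §Y The `HC_AV` row and the edge table, re-based (F-ab-43) -/

/-- **`HC_CM ⟹ HC_AV` along `(5)` modulo `h₂₁` and (Q_H) — and nothing else**: `(5) ⟹[Q_H] (β′ᵖᵗ) ⟹ CM-fibre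
lift ⟹[h₂₁, HC_CM] HC_AV`; part XII's `HC_AV_of_HC_CM_of_quasiInverseHodge_of_kernel_of_lefschetzBCMPointedPencils`
with its `hκ` binder met by the tree theorem (REFEREE-AB R-12 F-ab-43; the gate's append-only rule makes this a new
name rather than an edit). Every input a binder: `h₂₁` (André's Lemme 6.3.1, named fact), `hQ`, `hCM`, `h₅`.
research route, not a corollary; conditional on HC_CM plus one named minimal statement.
[cite: Andre1996Motifs, Lemme 6.3.1 (p. 31) and §6.3 a) (p. 33)] [cite: Abdulali1994FamiliesAV, Theorem 5.5 and Main Theorem 6.1 (b) (pp. 1130–1131)]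
[cite: VoisinHodgeII2003, §4.3.1 Thm. 4.18] -/
theorem HC_AV_of_HC_CM_of_quasiInverseHodge_of_lefschetzBCMPointedPencils
    (h₂₁ : andre1996_cmAnchoredPencil) (hQ : AlgebraicQuasiInverseOfLefschetzStandardHodge)
    (hCM : RankFourFaces.CMAbelianHodge) (h₅ : LefschetzBCMPointedPencils) :
    PadicSemiregularLift.HodgeAbelianVarieties :=
  HC_AV_of_HC_CM_of_quasiInverseHodge_of_kernel_of_lefschetzBCMPointedPencils h₂₁ hQ
    (fibreGysinKernelCompactPencils_of_deligne1968 deligne1968_invariantClass_fromTotalSpace_holds) hCM h₅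

/-- **The edge table of part XII re-based** (each arrow a theorem of parts XII/XIII; (Q_H) a case of the summit,
(φ) the one remaining print-true supply binder, (κ) a theorem, `h_T` Tankeev 2011): `(Q) ⟹ (Q_H)`, `HC ⟹ (Q_H)`,
and modulo (Q_H): `(5∀) ⟹ (β∀′ᵖᵗ)`, `(5∀) ⟹ (β∀′)`, `(5) ⟹ (β′ᵖᵗ)`, `(5) ⟹ (β′)`, `h_T ⟹ (β′)_2` — part XII's
`lefschetzB_to_fibreClass_chain_hodge` without its `hκ` binder (F-ab-43).
[cite: Andre1996Motifs, §6.3 Remarque 2 (p. 33)] [cite: Tankeev2011, main theorem (κ(X) < 3)] -/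
theorem lefschetzB_to_fibreClass_chain_hodge' (hφ : FibreClassConstantCompactPencils) :
    (AlgebraicQuasiInverseOfLefschetzStandard → AlgebraicQuasiInverseOfLefschetzStandardHodge) ∧
      (_root_.HodgeConjecture → AlgebraicQuasiInverseOfLefschetzStandardHodge) ∧
      (AlgebraicQuasiInverseOfLefschetzStandardHodge →
        (LefschetzBCompactPencils → FibreClassLefschetzPointwiseCompactPencils) ∧
          (LefschetzBCompactPencils → FibreClassLefschetzOnCompactPencils) ∧
          (LefschetzBCMPointedPencils → FibreClassLefschetzPointwiseCMPointedPencils) ∧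
          (LefschetzBCMPointedPencils → FibreClassLefschetzOnCMPointedPencils) ∧
          (Tankeev2011_lefschetzStandard_abelianSurfacePencilThreefold → FibreClassLefschetzOnAtRelDim 2)) :=
  lefschetzB_to_fibreClass_chain_hodge
    (fibreGysinKernelCompactPencils_of_deligne1968 deligne1968_invariantClass_fromTotalSpace_holds) hφ

end Summit.HodgeConjecture.HodgeConjecture.Ring2.AbelianAll

end
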